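import Mathlib
import Summits.ValiantsHypothesis.ValiantsHypothesis.Theorems.BarrierLeverPartitionMinorsHitByVPHiddenStatesJoinLaplace

/-!
# Route BarrierLever — item `PartitionMinorsHitByVP` (stmt-ValiantsHypothesis-19717), line `hidden_states`:
# NODE #1 AS A GIRTH STATEMENT — the generic row matroid of a design, `girth > r ⟺ universal at (h, r)`, and the generic-point rung

Helper file (`--supports stmt-ValiantsHypothesis-19717`; cell valiant-natproofs, rung V4, 𝒟-side door (c), line `hidden_states`,
node #1 `stub_universalJoinWide` (by name; registered as `stub_gadgetUniversal`); prover seat val-np-p3 gen 22; planner RULING R70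
(G2), HOME/STATUS.md l.1935). Bookkeeping `def`s only (`pt`, `evalMat`, `Indep`, the typed statements `Stmt.girthExceeds`,
`Stmt.universalFor`, and an explicit indicator table `freeTab`). Closes NO item.

THE POINT. Fix a join design `e : Fin r → Fin m × Finset (Fin K)` (column `k` = piece `(e k).1` and state set `(e k).2`; under a
table `tx` it is the point `pt e tx k = tx p none + Σ_{q ∈ J} tx p (some q) ∈ ℂ^h`). A row is a subset `U ⊆ Fin h`, read as the
multilinear monomial `x^U`; the entry of the block-additive matrix is `x^U (pt e tx k)`. The GENERIC ROW MATROID `M(e)` of the design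
on the ground set `2^{Fin h}` declares a row family `v` INDEPENDENT (`Indep e v`) iff SOME table makes the rows of the rectangular
evaluation matrix `evalMat v e tx` linearly independent (equivalently: a generic table does). In this language

* the body of node #1 for the FIXED design (`Stmt.universalFor h e`: every injective `u : Fin r → Finset (Fin h)` has a table with
  `det (joinMat u e tx) ≠ 0`) is EQUIVALENT to `Stmt.girthExceeds h e r` (every injective family of `t ≤ r` rows is independent,
  i.e. the girth of `M(e)` exceeds `r`, i.e. `M(e)` is the uniform matroid `U_{r, 2^h}`) — `universalFor_iff_girthExceeds`
  (needs only `r ≤ 2^h`, which the node has); equivalently (`universalFor_iff_hitting`): the `r` design points over a generic table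
  are a TIGHT HITTING SET for `r`-sparse multilinear polynomials — no nonzero polynomial supported on `≤ r` monomials `x^U` vanishes
  at all `r` points;
* every LAW of the line (a row family dependent for EVERY table: `¬ Indep e v`) is an upper bound `girth ≤ |v|` and refutes
  universality of that design at that `(h, r)` (`not_universalFor_of_not_indep`); every FREE-REGION theorem is a lower bound;
* RUNG 0 of the girth lower bound (`indep_of_free_columns`, `girthExceeds_of_free_columns`): columns with at most ONE state
  (origins `(p, ∅)` and axis points `(p, {q})`) are jointly FREE points — the indicator table `freeTab` sends them to the indicator
  vectors `1_{v j}` of any prescribed rows, where the evaluation matrix is the zeta matrix `[v i ⊆ v j]` — so EVERY injective family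
  of at most `#{free columns}` rows is independent: `girth(M(e)) > #{k : |(e k).2| ≤ 1}` for every design. For the design of record
  (≤ 2h saturated pair balls on `b` states each) this is `girth > m(b+1)` for free; the first rung that needs the pair points
  `o_p + g_q + g_q'` is the open one (R70 (G3)).
* `node1_iff_girth`: the body of `Stmt.stub_universalJoinWide` (VERBATIM the text of `Cruxes/PartitionMinorsHitByVP/Lines/hidden_states.lean`)
  ⟺ «for all large `h` and every `r ≤ 2^h` some legal wide design has girth `> r`».

WHAT THIS IS NOT: no new case of node #1 is proved here (the free-column rung is the star-join range of `…HiddenStatesStarJoins`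
read column-free); item 19717 stays OPEN; nothing on crux 14610 or VP ≠ VNP, which is NOT proved.
-/

set_option linter.dupNamespace false

namespace Summit.ValiantsHypothesis.ValiantsHypothesis.Theorems.BarrierLever.HiddenStates

open Finset Matrix

noncomputable section

namespace Girth

variable {h m K r : ℕ}

/-! ## 1. Points, evaluation matrices, generic independence -/

/-- The point of column `k` of the design `e` under the table `tx`: `tx p none + Σ_{q ∈ J} tx p (some q)` for `e k = (p, J)`. -/
def pt (e : Fin r → Fin m × Finset (Fin K)) (tx : Fin m → Option (Fin K) → Fin h → ℂ) (k : Fin r) : Fin h → ℂ :=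
  fun a => tx (e k).1 none a + ∑ q ∈ (e k).2, tx (e k).1 (some q) a

/-- The rectangular evaluation matrix of a row family `v` (rows = monomials `x^{v i}`) at the design points. -/
def evalMat {t : ℕ} (v : Fin t → Finset (Fin h)) (e : Fin r → Fin m × Finset (Fin K))
    (tx : Fin m → Option (Fin K) → Fin h → ℂ) : Matrix (Fin t) (Fin r) ℂ :=
  Matrix.of fun i k => ∏ a ∈ v i, pt e tx k a

/-- The square evaluation matrix is the join matrix of node #1 (`JoinLaplace.joinMat`). -/
theorem evalMat_eq_joinMat (u : Fin r → Finset (Fin h)) (e : Fin r → Fin m × Finset (Fin K))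
    (tx : Fin m → Option (Fin K) → Fin h → ℂ) : evalMat u e tx = JoinLaplace.joinMat u e tx := rfl

/-- **Generic independence** of a row family against the design: SOME table makes the rows of the evaluation matrix linearly
independent (the independent sets of the generic row matroid `M(e)` on the ground set `2^{Fin h}`). -/
def Indep {t : ℕ} (e : Fin r → Fin m × Finset (Fin K)) (v : Fin t → Finset (Fin h)) : Prop :=
  ∃ tx : Fin m → Option (Fin K) → Fin h → ℂ, LinearIndependent ℂ (fun i => evalMat v e tx i)

/-- **Typed statement (NOT asserted): the girth of `M(e)` exceeds `s`** — every injective family of at most `s` rows is independent. -/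
def Stmt.girthExceeds (h : ℕ) (e : Fin r → Fin m × Finset (Fin K)) (s : ℕ) : Prop :=
  ∀ t : ℕ, t ≤ s → ∀ v : Fin t → Finset (Fin h), Function.Injective v → Indep e v

/-- **Typed statement (NOT asserted): node #1 for the FIXED design `e` at `(h, r)`** — every injective row family of size `r` has a
table with nonsingular join matrix. -/
def Stmt.universalFor (h : ℕ) (e : Fin r → Fin m × Finset (Fin K)) : Prop :=
  ∀ u : Fin r → Finset (Fin h), Function.Injective u →
    ∃ tx : Fin m → Option (Fin K) → Fin h → ℂ, (JoinLaplace.joinMat u e tx).det ≠ 0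

/-! ## 2. Bookkeeping: sub-families, more columns, the square case -/

/-- A sub-family of an independent family is independent. -/
theorem Indep.comp {t t' : ℕ} {e : Fin r → Fin m × Finset (Fin K)} {v : Fin t → Finset (Fin h)} (hv : Indep e v)
    (ι : Fin t' → Fin t) (hι : Function.Injective ι) : Indep e (v ∘ ι) := by
  obtain ⟨tx, htx⟩ := hv
  refine ⟨tx, ?_⟩
  have hrows : (fun i => evalMat (v ∘ ι) e tx i) = (fun i => evalMat v e tx i) ∘ ι := by
    funext i; funext k; simp [evalMat]
  rw [hrows]
  exact htx.comp ι hι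

/-- MORE COLUMNS ONLY HELP: if `e` is the restriction of `e'` along `ι`, independence against `e` gives independence against `e'`. -/
theorem Indep.of_restrict {r' t : ℕ} {e' : Fin r' → Fin m × Finset (Fin K)} (ι : Fin r → Fin r')
    {v : Fin t → Finset (Fin h)} (hv : Indep (e' ∘ ι) v) : Indep e' v := by
  obtain ⟨tx, htx⟩ := hv
  refine ⟨tx, ?_⟩
  -- restriction of coordinates along `ι` is linear and maps the rows of `evalMat v e' tx` to those of `evalMat v (e' ∘ ι) tx`
  let f : (Fin r' → ℂ) →ₗ[ℂ] (Fin r → ℂ) := LinearMap.funLeft ℂ ℂ ι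
  have hcomp : f ∘ (fun i => evalMat v e' tx i) = fun i => evalMat v (e' ∘ ι) tx i := by
    funext i; funext k
    simp [f, LinearMap.funLeft_apply, evalMat, pt]
  exact LinearIndependent.of_comp f (by rw [hcomp]; exact htx)

/-- Monotonicity of the girth statement in `s`. -/
theorem Stmt.girthExceeds_mono {e : Fin r → Fin m × Finset (Fin K)} {s s' : ℕ} (hs : s' ≤ s)
    (H : Stmt.girthExceeds h e s) : Stmt.girthExceeds h e s' :=
  fun t ht v hv => H t (ht.trans hs) v hv

/-- The square case: independence of `r` rows against `r` columns is nonsingularity of the join matrix for some table. -/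
theorem indep_iff_exists_det_ne_zero (e : Fin r → Fin m × Finset (Fin K)) (u : Fin r → Finset (Fin h)) :
    Indep e u ↔ ∃ tx : Fin m → Option (Fin K) → Fin h → ℂ, (JoinLaplace.joinMat u e tx).det ≠ 0 := by
  constructor
  · rintro ⟨tx, htx⟩
    refine ⟨tx, ?_⟩
    rw [← evalMat_eq_joinMat]
    have hU : IsUnit (evalMat u e tx) := Matrix.linearIndependent_rows_iff_isUnit.mp htx
    exact ((Matrix.isUnit_iff_isUnit_det _).mp hU).ne_zero
  · rintro ⟨tx, htx⟩
    exact ⟨tx, by rw [evalMat_eq_joinMat]; exact Matrix.linearIndependent_rows_of_det_ne_zero htx⟩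

/-! ## 3. `universalFor ⟺ girthExceeds r` -/

/-- Any injective family of `t ≤ r ≤ 2^h` subsets of `Fin h` extends to an injective family of `r` subsets. -/
theorem exists_extension {t : ℕ} (hr : r ≤ 2 ^ h) (ht : t ≤ r) (v : Fin t → Finset (Fin h))
    (hv : Function.Injective v) :
    ∃ (u : Fin r → Finset (Fin h)) (ι : Fin t → Fin r), Function.Injective u ∧ Function.Injective ι ∧ u ∘ ι = v := by
  classical
  -- the unused subsets
  set S : Finset (Finset (Fin h)) := Finset.univ.filter fun U => U ∉ Set.range v with hS
  have hScard : r - t ≤ S.card := by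
    have himg : (Finset.univ.image v).card = t := by
      rw [Finset.card_image_of_injective _ hv, Finset.card_univ, Fintype.card_fin]
    have hSeq : S = (Finset.univ.image v)ᶜ := by
      ext U
      simp only [hS, Finset.mem_filter, Finset.mem_univ, true_and, Finset.mem_compl, Finset.mem_image, Set.mem_range,
        not_exists]
    rw [hSeq, Finset.card_compl, himg, Fintype.card_finset, Fintype.card_fin]
    omega
  -- an injection of `Fin (r - t)` into `S`
  let g : Fin (r - t) → Finset (Fin h) := fun j => (S.equivFin.symm (Fin.castLE hScard j)).1
  have hgmem : ∀ j, g j ∈ S := fun j => (S.equivFin.symm (Fin.castLE hScard j)).2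
  have hginj : Function.Injective g := by
    intro j j' hjj'
    have := Subtype.ext (a1 := S.equivFin.symm (Fin.castLE hScard j)) (a2 := S.equivFin.symm (Fin.castLE hScard j')) hjj'
    have := S.equivFin.symm.injective this
    exact Fin.castLE_injective hScard this
  have hgv : ∀ j i, g j ≠ v i := by
    intro j i hji
    have hm := hgmem j
    simp only [hS, Finset.mem_filter, Finset.mem_univ, true_and, Set.mem_range, not_exists] at hm
    exact hm i hji.symm
  have htr : t + (r - t) = r := by omega
  refine ⟨fun k => Fin.append v g (Fin.cast htr.symm k), fun i => Fin.cast htr (Fin.castAdd (r - t) i), ?_, ?_, ?_⟩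
  · intro k k' hkk'
    have hinj : Function.Injective (Fin.append v g) := by
      intro x x' hxx'
      induction x using Fin.addCases with
      | left i =>
        induction x' using Fin.addCases with
        | left i' => simp only [Fin.append_left] at hxx'; rw [hv hxx']
        | right j' => simp only [Fin.append_left, Fin.append_right] at hxx'; exact absurd hxx'.symm (hgv j' i)
      | right j =>
        induction x' using Fin.addCases with
        | left i' => simp only [Fin.append_left, Fin.append_right] at hxx'; exact absurd hxx' (hgv j i')
        | right j' => simp only [Fin.append_right] at hxx'; rw [hginj hxx']
    exact Fin.cast_injective _ (hinj hkk')
  · intro i i' hii'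
    have := Fin.cast_injective _ hii'
    exact Fin.castAdd_injective _ _ this
  · funext i
    have hcc : Fin.cast htr.symm (Fin.cast htr (Fin.castAdd (r - t) i)) = Fin.castAdd (r - t) i := Fin.ext rfl
    simp only [Function.comp_apply, hcc, Fin.append_left]

/-- **NODE #1 AT `(h, r)` FOR A FIXED DESIGN ⟺ GIRTH OF ITS GENERIC ROW MATROID EXCEEDS `r`** (for `r ≤ 2^h`). -/
theorem universalFor_iff_girthExceeds (hr : r ≤ 2 ^ h) (e : Fin r → Fin m × Finset (Fin K)) :
    Stmt.universalFor h e ↔ Stmt.girthExceeds h e r := by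
  constructor
  · intro H t ht v hv
    obtain ⟨u, ι, hu, hι, huv⟩ := exists_extension hr ht v hv
    have hU : Indep e u := (indep_iff_exists_det_ne_zero e u).mpr (H u hu)
    rw [← huv]
    exact hU.comp ι hι
  · intro H u hu
    exact (indep_iff_exists_det_ne_zero e u).mp (H r le_rfl u hu)

/-- **A LAW REFUTES UNIVERSALITY OF THE DESIGN**: a family of `t ≤ r` rows dependent for every table (`¬ Indep e v`) shows the
design is not universal at `(h, r)` (`r ≤ 2^h`). This is how every law of the line is quoted as a girth upper bound. -/
theorem not_universalFor_of_not_indep (hr : r ≤ 2 ^ h) (e : Fin r → Fin m × Finset (Fin K)) {t : ℕ} (ht : t ≤ r)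
    (v : Fin t → Finset (Fin h)) (hv : Function.Injective v) (hdep : ¬ Indep e v) : ¬ Stmt.universalFor h e :=
  fun H => hdep ((universalFor_iff_girthExceeds hr e).mp H t ht v hv)

/-- A determinant form of a law: if some `r`-family has `det (joinMat u e tx) = 0` for EVERY table, the design is not universal. -/
theorem not_universalFor_of_det_eq_zero (e : Fin r → Fin m × Finset (Fin K)) (u : Fin r → Finset (Fin h))
    (hu : Function.Injective u) (hdet : ∀ tx : Fin m → Option (Fin K) → Fin h → ℂ, (JoinLaplace.joinMat u e tx).det = 0) :
    ¬ Stmt.universalFor h e := by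
  intro H
  obtain ⟨tx, htx⟩ := H u hu
  exact htx (hdet tx)

/-! ## 4. The hitting-set reading -/

/-- **`universalFor` ⟺ TIGHT HITTING SET**: for every injective `u` some table admits NO nonzero coefficient vector `c` with
`Σ_i c_i x^{u i}` vanishing at all `r` design points (an `r`-sparse multilinear polynomial supported on `u` killed by the points). -/
theorem universalFor_iff_hitting (e : Fin r → Fin m × Finset (Fin K)) :
    Stmt.universalFor h e ↔ ∀ u : Fin r → Finset (Fin h), Function.Injective u →
      ∃ tx : Fin m → Option (Fin K) → Fin h → ℂ, ∀ c : Fin r → ℂ,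
        (∀ k : Fin r, ∑ i, c i * ∏ a ∈ u i, pt e tx k a = 0) → c = 0 := by
  refine forall_congr' fun u => forall_congr' fun hu => ?_
  rw [← indep_iff_exists_det_ne_zero]
  refine exists_congr fun tx => ?_
  rw [Fintype.linearIndependent_iff]
  constructor
  · intro H c hc
    funext i
    refine H c ?_ i
    funext k
    have := hc k
    simpa [evalMat, Finset.sum_apply, Pi.smul_apply, smul_eq_mul] using this
  · intro H c hc i
    have hc' : ∀ k : Fin r, ∑ i, c i * ∏ a ∈ u i, pt e tx k a = 0 := by
      intro k
      have := congrFun hc k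
      simpa [evalMat, Finset.sum_apply, Pi.smul_apply, smul_eq_mul] using this
    exact congrFun (H c hc') i

/-! ## 5. Rung 0 of the girth lower bound: columns with at most one state are free points -/

section free

variable (e : Fin r → Fin m × Finset (Fin K)) {t : ℕ} (ι : Fin t → Fin r) (v : Fin t → Finset (Fin h))

/-- **The indicator table** for the free columns `ι j` (origins `(p, ∅)` and axis points `(p, {q})`): the point of column `ι j`
becomes the indicator vector `1_{v j}`; every other origin/state is `0`. -/
def freeTab : Fin m → Option (Fin K) → Fin h → ℂ := by
  classical
  exact fun p o a =>
    match o with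
    | none => if hp : ∃ j, e (ι j) = (p, ∅) then (if a ∈ v hp.choose then 1 else 0) else 0
    | some q => if hq : ∃ j, e (ι j) = (p, {q}) then
        ((if a ∈ v hq.choose then 1 else 0) -
          (if hp : ∃ j, e (ι j) = (p, ∅) then (if a ∈ v hp.choose then 1 else 0) else 0)) else 0

variable {e ι v}

/-- Under the indicator table the point of the free column `ι j` is `1_{v j}`. -/
theorem pt_freeTab (hinj : Function.Injective (e ∘ ι)) (hfree : ∀ j, ((e (ι j)).2).card ≤ 1) (j : Fin t) (a : Fin h) :
    pt e (freeTab e ι v) (ι j) a = if a ∈ v j then 1 else 0 := by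
  classical
  have hcard := hfree j
  rcases Nat.le_one_iff_eq_zero_or_eq_one.mp hcard with h0 | h1
  · -- origin column `(p, ∅)`
    have hJ : (e (ι j)).2 = ∅ := Finset.card_eq_zero.mp h0
    have hex : ∃ j', e (ι j') = ((e (ι j)).1, ∅) := ⟨j, by rw [← hJ]⟩
    have hch : hex.choose = j := by
      have h1 := hex.choose_spec
      have h2 : e (ι j) = ((e (ι j)).1, ∅) := by rw [← hJ]
      exact hinj (h1.trans h2.symm)
    simp only [pt, hJ, Finset.sum_empty, add_zero, freeTab, dif_pos hex, hch]
  · -- axis column `(p, {q})`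
    obtain ⟨q, hq⟩ := Finset.card_eq_one.mp h1
    have hex : ∃ j', e (ι j') = ((e (ι j)).1, {q}) := ⟨j, by rw [← hq]⟩
    have hch : hex.choose = j := by
      have h1' := hex.choose_spec
      have h2 : e (ι j) = ((e (ι j)).1, {q}) := by rw [← hq]
      exact hinj (h1'.trans h2.symm)
    simp only [pt, hq, Finset.sum_singleton, freeTab, dif_pos hex, hch]
    ring

/-- Under the indicator table the entry `(i, ι j)` of the evaluation matrix is the zeta entry `[v i ⊆ v j]`. -/
theorem evalMat_freeTab (hinj : Function.Injective (e ∘ ι)) (hfree : ∀ j, ((e (ι j)).2).card ≤ 1) (i j : Fin t) :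
    evalMat v e (freeTab e ι v) i (ι j) = if v i ⊆ v j then 1 else 0 := by
  simp only [evalMat, Matrix.of_apply, pt_freeTab hinj hfree]
  rw [Finset.prod_boole]
  by_cases hsub : v i ⊆ v j
  · rw [if_pos hsub, if_pos (fun a ha => hsub ha)]
  · rw [if_neg hsub, if_neg (fun hall => hsub (fun a ha => hall a ha))]

/-- The zeta matrix of an injective family has no nonzero ROW relation: `Σ_i c_i [v i ⊆ v j] = 0 ∀ j ⇒ c = 0`
(look at a nonzero coefficient of minimal cardinality). -/
theorem eq_zero_of_zeta_rows (hv : Function.Injective v) (c : Fin t → ℂ)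
    (hc : ∀ j, ∑ i, c i * (if v i ⊆ v j then (1 : ℂ) else 0) = 0) : c = 0 := by
  classical
  by_contra hne
  have hne' : ∃ i, c i ≠ 0 := by
    by_contra hall
    push Not at hall
    exact hne (funext hall)
  obtain ⟨i₀, hi₀, hmin⟩ := Finset.exists_min_image (Finset.univ.filter fun i => c i ≠ 0) (fun i => (v i).card)
    (by obtain ⟨i, hi⟩ := hne'; exact ⟨i, by simpa using hi⟩)
  have hc₀ : c i₀ ≠ 0 := by simpa using hi₀
  have hsum := hc i₀
  rw [Finset.sum_eq_single i₀] at hsum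
  · simp at hsum
    exact hc₀ hsum
  · intro i _ hi
    by_cases hci : c i = 0
    · rw [hci, zero_mul]
    · have hcard : (v i₀).card ≤ (v i).card := hmin i (by simpa using hci)
      have hnot : ¬ v i ⊆ v i₀ := by
        intro hsub
        have heq : v i = v i₀ := Finset.eq_of_subset_of_card_le hsub hcard
        exact hi (hv heq)
      rw [if_neg hnot, mul_zero]
  · intro h; exact absurd (Finset.mem_univ i₀) h

/-- **RUNG 0 — FREE COLUMNS ARE FREE POINTS.** If `t` columns `ι j` of the design (pairwise distinct as pairs `(p, J)`) carry at most
one state each, then EVERY injective family of `t` rows is independent in `M(e)` (indicator table + zeta matrix). -/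
theorem indep_of_free_columns (hinj : Function.Injective (e ∘ ι)) (hfree : ∀ j, ((e (ι j)).2).card ≤ 1)
    (hv : Function.Injective v) : Indep e v := by
  classical
  refine ⟨freeTab e ι v, ?_⟩
  rw [Fintype.linearIndependent_iff]
  intro c hc i
  have hcols : ∀ j, ∑ i, c i * (if v i ⊆ v j then (1 : ℂ) else 0) = 0 := by
    intro j
    have := congrFun hc (ι j)
    simp only [Finset.sum_apply, Pi.smul_apply, smul_eq_mul, Pi.zero_apply] at this
    simpa only [evalMat_freeTab hinj hfree] using this
  exact congrFun (eq_zero_of_zeta_rows hv c hcols) i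

end free

/-- **`girth(M(e)) > #free columns`** for every design: with `s` pairwise distinct columns of at most one state, every injective
family of `t ≤ s` rows is independent. (For a join of `m` pair balls on `b` states with origins: `girth > m(b+1)`.) -/
theorem girthExceeds_of_free_columns (e : Fin r → Fin m × Finset (Fin K)) {s : ℕ} (ι : Fin s → Fin r)
    (hinj : Function.Injective (e ∘ ι)) (hfree : ∀ j, ((e (ι j)).2).card ≤ 1) : Stmt.girthExceeds h e s := by
  intro t ht v hv
  have hinj' : Function.Injective (e ∘ (ι ∘ Fin.castLE ht)) := hinj.comp (Fin.castLE_injective ht)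
  exact indep_of_free_columns (ι := ι ∘ Fin.castLE ht) hinj' (fun j => hfree _) hv

/-! ## 6. Node #1 read column-free -/

/-- **NODE #1 ⟺ «for all large `h` and every `r ≤ 2^h` some legal wide design has girth `> r`».** The left side is VERBATIM the
body of `Stmt.stub_universalJoinWide` of `Cruxes/PartitionMinorsHitByVP/Lines/hidden_states.lean`. -/
theorem node1_iff_girth :
    (∃ h₁ : ℕ, ∀ h : ℕ, h₁ ≤ h → ∀ r : ℕ, r ≤ 2 ^ h →
      ∃ (m K : ℕ) (W : Fin m → ℕ) (wt : Fin m → Fin K → ℕ) (e : Fin r → Fin m × Finset (Fin K)),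
        m ≤ h + h ∧ K ≤ h * h * h ∧ Function.Injective e ∧
        (∀ x : Fin m × Finset (Fin K), x ∉ Set.range e →
          ∀ i, W (e i).1 + ∑ k ∈ (e i).2, wt (e i).1 k < W x.1 + ∑ k ∈ x.2, wt x.1 k) ∧
        ∀ u : Fin r → Finset (Fin h), Function.Injective u →
          ∃ tx : Fin m → Option (Fin K) → Fin h → ℂ,
            (Matrix.of fun i k : Fin r =>
              ∏ a ∈ u i, (tx (e k).1 none a + ∑ q ∈ (e k).2, tx (e k).1 (some q) a)).det ≠ 0) ↔
    (∃ h₁ : ℕ, ∀ h : ℕ, h₁ ≤ h → ∀ r : ℕ, r ≤ 2 ^ h →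
      ∃ (m K : ℕ) (W : Fin m → ℕ) (wt : Fin m → Fin K → ℕ) (e : Fin r → Fin m × Finset (Fin K)),
        m ≤ h + h ∧ K ≤ h * h * h ∧ Function.Injective e ∧
        (∀ x : Fin m × Finset (Fin K), x ∉ Set.range e →
          ∀ i, W (e i).1 + ∑ k ∈ (e i).2, wt (e i).1 k < W x.1 + ∑ k ∈ x.2, wt x.1 k) ∧
        Stmt.girthExceeds h e r) := by
  refine exists_congr fun h₁ => forall_congr' fun h => forall_congr' fun hh => forall_congr' fun r =>
    forall_congr' fun hr => exists_congr fun m => exists_congr fun K => exists_congr fun W => exists_congr fun wt =>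
    exists_congr fun e => and_congr_right fun _ => and_congr_right fun _ => and_congr_right fun _ =>
    and_congr_right fun _ => ?_
  exact universalFor_iff_girthExceeds hr e

end Girth

end

end Summit.ValiantsHypothesis.ValiantsHypothesis.Theorems.BarrierLever.HiddenStates
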